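import Summits.Ventures.CertifiedManyBodySolver.Downfold.EmeryShapeTrueCornerBand
import Summits.Ventures.CertifiedManyBodySolver.Downfold.EmeryFermiScalePointsHg1201TrueCorners
import Summits.Ventures.CertifiedManyBodySolver.Downfold.EmeryFermiScalePointsHg1201VirtualCorners
import HarnessLib

/-!
# THE ONE-BAND FERMI-SURFACE SHAPE `t′/t` OF THE WHOLE TYPED 3BE BOX `emeryBoxHg1201 (EmeryBoxesCuprates)` OVER ITS WHOLE FILLING BAND, AT ITS TWO TRUE CORNERS (true-corner rule, band form,
# §B.87 (j); router/EMERY-SHAPE-CORNERS.tsv «true band» rows)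

Venture CertifiedManyBodySolver, cell `pub/hubbard-downfold` (stage S1; INFLATION-RULES-3to1-B §B.87 (j)), seat hubbard-downfold-mod-4 (technique B, g35); namespace
`Summit.Ventures.CertifiedManyBodySolver.Downfold.Emery`. Everything PROVED (0 sorry; no new certificate — the end-filling brackets of the per-filling files are re-read).
WHAT THIS IS NOT: a statement about HgBa₂CuO₄ (box #19, P = 0) — the typed box is SCREENING-GRADE; `U = 0` one-body kinematics of the σ model (rigid band).

For EVERY one-body row of `[1.4, 2.5] × [1.12, 1.32] × [0.64, 0.85] × [0.161, 0.208]` eV AND EVERY filling `ν ∈ [21/50, 7/16]` the one-band `t′/t` lies in **[-0.3654, -0.264]**: the true-corner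
squeeze `fsRatio_fermiEnergyOf_trueCorner_lower_band` / `…_upper_band` (`EmeryShapeTrueCornerBand`: slab windows `[pL, qL] = [3011/2000, 841/500]`, `[pU, qU] = [757/500, 1033/625]`, regime `qT = 511/250`
certified at the END fillings; margin constants lower slab M_b 0.0611 / M_c 0.8932, upper slab M_b 1.8484 / M_c 0.6367), read at the true corners over their band windows
`[15797/10000, 16399/10000]` (antitone) and `[1937/1250, 15921/10000]` (monotone) (`fermiEnergyOf_mem_Icc_of_band`). Comparator (certified, g19 sub-box device, n_H band): [-0.3717,-0.2486] (v114 t_pp′ [0.111,0.208], n_H band).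

Sources: three-band model [HybertsenSchluterChristensen1989, Eq. (1)]; [AndersenEtAl1995, §6]; box rows as cited in the typed object's file.
-/

noncomputable section

namespace Summit.Ventures.CertifiedManyBodySolver.Downfold.Emery

open Real Set

/-- **filling band ν ∈ [21/50, 7/16] (n_H = 1.16 (ν = 21/50) … n_H = 1.125 (ν = 7/16)): for every row of the box AND every filling of the band the one-band Fermi-surface `t′/t` (object E) lies in `[-0.3654, -0.264]` — between its values at the two TRUE corners** (band form of the true-corner rule; margins by `norm_num`). [folklore] -/
theorem hg1201Box_fsRatio_true_band {Δ a b c ν : ℝ} (hΔ : Δ ∈ Icc ((7 : ℝ) / 5) ((5 : ℝ) / 2)) (ha : a ∈ Icc ((28 : ℝ) / 25) ((33 : ℝ) / 25)) (hb : b ∈ Icc ((16 : ℝ) / 25) ((17 : ℝ) / 20)) (hc : c ∈ Icc ((161 : ℝ) / 1000) ((26 : ℝ) / 125)) (hν : ν ∈ Icc ((21 : ℝ) / 50) ((7 : ℝ) / 16)) :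
    fsRatio Δ a b c (fermiEnergyOf Δ a b c ν) ∈ Icc ((-1827 : ℝ) / 5000) ((-33 : ℝ) / 125) := by
  have hSL := (fermiEnergyOf_of_pointBracketCheck truePt_Hg1201SL_nH116_br (by norm_num) (by norm_num) (by norm_num) (ν := (21/50 : ℝ)) (by push_cast; exact ⟨le_rfl, le_rfl⟩)).2
  have hAlo := (fermiEnergyOf_of_pointBracketCheck virtPt_Hg1201Alo_nH1125_br (by norm_num) (by norm_num) (by norm_num) (ν := (7/16 : ℝ)) (by push_cast; exact ⟨le_rfl, le_rfl⟩)).2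
  have hTop := (fermiEnergyOf_of_pointBracketCheck virtPt_Hg1201H_nH1125_br (by norm_num) (by norm_num) (by norm_num) (ν := (7/16 : ℝ)) (by push_cast; exact ⟨le_rfl, le_rfl⟩)).2
  have hSU := (fermiEnergyOf_of_pointBracketCheck truePt_Hg1201SU_nH116_br (by norm_num) (by norm_num) (by norm_num) (ν := (21/50 : ℝ)) (by push_cast; exact ⟨le_rfl, le_rfl⟩)).2
  have hQU := (fermiEnergyOf_of_pointBracketCheck truePt_Hg1201QU_nH1125_br (by norm_num) (by norm_num) (by norm_num) (ν := (7/16 : ℝ)) (by push_cast; exact ⟨le_rfl, le_rfl⟩)).2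
  have hTL1 := (fermiEnergyOf_of_pointBracketCheck truePt_Hg1201TL_nH116_br (by norm_num) (by norm_num) (by norm_num) (ν := (21/50 : ℝ)) (by push_cast; exact ⟨le_rfl, le_rfl⟩)).2
  have hTL2 := (fermiEnergyOf_of_pointBracketCheck truePt_Hg1201TL_nH1125_br (by norm_num) (by norm_num) (by norm_num) (ν := (7/16 : ℝ)) (by push_cast; exact ⟨le_rfl, le_rfl⟩)).2
  have hTH1 := (fermiEnergyOf_of_pointBracketCheck truePt_Hg1201TH_nH116_br (by norm_num) (by norm_num) (by norm_num) (ν := (21/50 : ℝ)) (by push_cast; exact ⟨le_rfl, le_rfl⟩)).2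
  have hTH2 := (fermiEnergyOf_of_pointBracketCheck truePt_Hg1201TH_nH1125_br (by norm_num) (by norm_num) (by norm_num) (ν := (7/16 : ℝ)) (by push_cast; exact ⟨le_rfl, le_rfl⟩)).2
  push_cast at hSL hAlo hTop hSU hQU hTL1 hTL2 hTH1 hTH2
  norm_num at hSL hAlo hTop hSU hQU hTL1 hTL2 hTH1 hTH2
  obtain ⟨hΔl, hΔu⟩ := hΔ
  obtain ⟨hal, hau⟩ := ha
  have hTL := fermiEnergyOf_mem_Icc_of_band (Δ := ((7 : ℝ) / 5)) (a := ((28 : ℝ) / 25)) (b := ((17 : ℝ) / 20)) (c := ((26 : ℝ) / 125)) (e₁ := ((15797 : ℝ) / 10000)) (e₂ := ((16399 : ℝ) / 10000)) (by norm_num) (by norm_num) (by norm_num) (by norm_num) (by norm_num) hν (by norm_num) hTL1.1 hTL2.2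
  have hTH := fermiEnergyOf_mem_Icc_of_band (Δ := ((5 : ℝ) / 2)) (a := ((33 : ℝ) / 25)) (b := ((16 : ℝ) / 25)) (c := ((161 : ℝ) / 1000)) (e₁ := ((1937 : ℝ) / 1250)) (e₂ := ((15921 : ℝ) / 10000)) (by norm_num) (by norm_num) (by norm_num) (by norm_num) (by norm_num) hν (by norm_num) hTH1.1 hTH2.2
  constructor
  · have hlow := fsRatio_fermiEnergyOf_trueCorner_lower_band (Δ₁ := ((7 : ℝ) / 5)) (a₁ := ((28 : ℝ) / 25)) (b₁ := ((16 : ℝ) / 25)) (b₂ := ((17 : ℝ) / 20)) (c₁ := ((161 : ℝ) / 1000)) (c₂ := ((26 : ℝ) / 125)) (ν₁ := ((21 : ℝ) / 50)) (ν₂ := ((7 : ℝ) / 16))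
      (pL := ((3011 : ℝ) / 2000)) (qL := ((841 : ℝ) / 500)) (Mb := ((611 : ℝ) / 10000)) (Mc := ((2233 : ℝ) / 2500)) (by norm_num) hΔl (by norm_num) hal (by norm_num) hb (by norm_num) hc (by norm_num) (by norm_num) hν (by norm_num)
      (by norm_num) hSL.1 hAlo.2 (by norm_num) (by norm_num [fsD, fsN]) (by norm_num) (by norm_num) (by norm_num [fsD, fsN]) (by norm_num) (by norm_num [dopingDisc]) (by norm_num [fsD, fsN])
    refine le_trans ?_ hlow
    have hw := (fsRatio_mem_Icc_on_window_of_dopingDisc_nonneg (Δ := ((7 : ℝ) / 5)) (a := ((28 : ℝ) / 25)) (b := ((17 : ℝ) / 20)) (c := ((26 : ℝ) / 125))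
      (p := ((15797 : ℝ) / 10000)) (q := ((16399 : ℝ) / 10000)) (by norm_num) (by norm_num) (by norm_num) (by norm_num) (by norm_num) (by norm_num) (by norm_num) (by norm_num [dopingDisc]) hTL).1
    refine le_trans ?_ hw
    norm_num [fsRatio, fsD, fsN]
  · have hup := fsRatio_fermiEnergyOf_trueCorner_upper_band (Δ₁ := ((7 : ℝ) / 5)) (Δ₂ := ((5 : ℝ) / 2)) (a₁ := ((28 : ℝ) / 25)) (a₂ := ((33 : ℝ) / 25)) (b₁ := ((16 : ℝ) / 25)) (b₂ := ((17 : ℝ) / 20)) (c₁ := ((161 : ℝ) / 1000)) (c₂ := ((26 : ℝ) / 125)) (ν₁ := ((21 : ℝ) / 50)) (ν₂ := ((7 : ℝ) / 16))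
      (pU := ((757 : ℝ) / 500)) (qU := ((1033 : ℝ) / 625)) (qT := ((511 : ℝ) / 250)) (Mb := ((4621 : ℝ) / 2500)) (Mc := ((6367 : ℝ) / 10000)) (by norm_num) ⟨hΔl, hΔu⟩ (by norm_num) ⟨hal, hau⟩ (by norm_num) hb (by norm_num) hc (by norm_num) (by norm_num) hν (by norm_num)
      hTop.2 (by norm_num) (by norm_num) hSU.1 hQU.2 (by norm_num) (by norm_num [fsD, fsN]) (by norm_num) (by norm_num) (by norm_num [fsD, fsN]) (by norm_num) (by norm_num) (by norm_num [fsD, fsN])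
    refine le_trans hup ?_
    have hw := (fsRatio_mem_Icc_on_window_of_dopingDisc_nonpos (Δ := ((5 : ℝ) / 2)) (a := ((33 : ℝ) / 25)) (b := ((16 : ℝ) / 25)) (c := ((161 : ℝ) / 1000))
      (p := ((1937 : ℝ) / 1250)) (q := ((15921 : ℝ) / 10000)) (by norm_num) (by norm_num) (by norm_num) (by norm_num) (by norm_num) (by norm_num) (by norm_num) (by norm_num [dopingDisc]) hTH).2
    refine le_trans hw ?_
    norm_num [fsRatio, fsD, fsN]

end Summit.Ventures.CertifiedManyBodySolver.Downfold.Emery
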